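import Mathlib
import HarnessLib
import Summits.NavierStokesRegularity.NavierStokesRegularity.Theorems.PoloidalWindowDoorLrcModEntireCaseISfreeBranch
import Summits.NavierStokesRegularity.NavierStokesRegularity.Theorems.PoloidalWindowDoorLrcModEntireSlopeBox

/-!
# Route `PoloidalWindowDoor`, item `LrcModEntire` (stmt-NavierStokesRegularity-20428), cell (Q4-sonic), slot `stub_Q4sonicLineNeg` —
# CASE I, s-FREE BRANCH ⇒ `False`, with the slope hypotheses discharged (box form)

Cell ns-regularity-ideate, helper seat ns-k2-port-2 g8 under the LEAD of item 20428 (ns-poloidal-K2-p3 g17); `--supports stmt-NavierStokesRegularity-20428 --as helper`.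

* ★★★ `caseI_sfree_false_box` — `…CaseISfreeBranch.caseI_sfree_false` on the full parameter box `O = {(t,s,z) : |t+1| < δ′, |z| < δ′}` with `Dμ :=` the
  `(t,z)`-box, the smoothness and `μ ≠ 1` inputs supplied by `…SlopeBox`.  REMAINING HYPOTHESES: the class profile (poloidal, `U₂(−1,0) ≠ 0`), the (TH) slab law, the
  output block of `…Q4TimeWebPackage.time_web_package_line`, CASE I on the box (`hsonI`, `hparI`) and **the s-free sheet data `P = Q = 0` on `{m = 0}`** (S3(e)).
WHAT THIS IS NOT: not a claim about Navier–Stokes regularity and not a registry stub: the s-free sub-branch of case I of the research slot `stub_Q4sonicLineNeg`, closed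
modulo its sheet-data input; `stub_Q4sonicLineNeg` / ⟨20428⟩ / ⟨19708⟩ / ⟨27893⟩ OPEN.
-/

noncomputable section

set_option linter.dupNamespace false
set_option linter.style.longLine false

namespace Summit.NavierStokesRegularity.NavierStokesRegularity.Theorems.PoloidalWindowDoorLrcModEntireCaseISfreeBox

open Set Function Filter Topology Metric
open scoped RealInnerProductSpace InnerProductSpace ContDiff
open Literature.Analysis
open Summit.NavierStokesRegularity.NavierStokesRegularity.Theorems.PoloidalWindowDoorLrcModEntireSheetSystemUniqueness
open Summit.NavierStokesRegularity.NavierStokesRegularity.Theorems.PoloidalWindowDoorLrcModEntireSheetFlattenTools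
open Summit.NavierStokesRegularity.NavierStokesRegularity.Theorems.PoloidalWindowDoorLrcModEntireShearedCoordinates
open Summit.NavierStokesRegularity.NavierStokesRegularity.Theorems.PoloidalWindowDoorLrcModEntireShearedKinematics
open Summit.NavierStokesRegularity.NavierStokesRegularity.Theorems.PoloidalWindowDoorLrcModEntireCaseISfreeBranch
open Summit.NavierStokesRegularity.NavierStokesRegularity.Theorems.PoloidalWindowDoorLrcModEntireSlopeBox

variable {C : ℝ} {U : ℝ → E3 → E3} {R μ : ℝ → ℝ → ℝ} {σ r ρ δ' : ℝ} {e : E3} {n₀ : ℝ × ℝ × ℝ → ℝ} {κt : ℝ → ℝ → ℝ}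

/-- ★★★ **CASE I, s-FREE BRANCH ⇒ `False` (box form, slope hypotheses discharged).**  See the module docstring. -/
theorem caseI_sfree_false_box
    (hrate : FluidPDE.HasTypeITimeDecay C U) (hcont : ContinuousOn (uncurry U) (Iio (0 : ℝ) ×ˢ univ))
    (hmild : ∀ s t : ℝ, s < t → t < 0 → ∀ x, U t x = UnboundedOperators.heatExtension (U s) (t - s) x - FluidPDE.oseenDuhamel 1 s U U t x)
    (hdiv : ∀ t < 0, FluidPDE.VectorCalculus.IsDivFree (U t))
    (hpol : ∀ s < 0, ∀ y, ⟪FluidPDE.curl (U s) y, EuclideanSpace.single 2 1⟫_ℝ = 0)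
    (hUne : U (-1) 0 2 ≠ 0)
    (hσ : σ = 1 ∨ σ = -1) (hμ3 : ContDiff ℝ 3 (uncurry μ))
    (hslabU : ∀ t : ℝ, |t + 1| < ρ → ∀ x : E3, |x 2| < ρ → ∀ b : Fin 3, b ≠ 2 →
      fderiv ℝ (U t) x (EuclideanSpace.single 2 1) b = μ t (x 2) * fderiv ℝ (U t) x (EuclideanSpace.single b 1) 2)
    (hδ' : 0 < δ') (hδ'ρ : δ' ≤ ρ) (hδ'h : δ' < 1 / 2) (he2 : e 2 = 0) (hunit : e 0 ^ 2 + e 1 ^ 2 = 1)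
    (hpack : ∀ q : ℝ × ℝ × ℝ, |q.1| < δ' → |q.2.2| < δ' →
        n₀ q ∈ Ioo (-r) r ∧
        σ * U (-1 + q.1) (frameCLM e (q.2.1, n₀ q, q.2.2)) 2 = R q.1 q.2.2 ∧
        (∀ n ∈ Icc (-r) r, n ≠ n₀ q → σ * U (-1 + q.1) (frameCLM e (q.2.1, n, q.2.2)) 2 < R q.1 q.2.2) ∧
        (∀ w : E3, w 2 = 0 → fderiv ℝ (fun y => U (-1 + q.1) y 2) (frameCLM e (q.2.1, n₀ q, q.2.2)) w = 0) ∧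
        (∀ m : ℕ∞, ContDiffAt ℝ m n₀ q) ∧
        0 < κt q.1 q.2.2 ∧
        fderiv ℝ (fderiv ℝ (fun y => σ * U (-1 + q.1) y 2)) (frameCLM e (q.2.1, n₀ q, q.2.2)) e e +
            fderiv ℝ (fderiv ℝ (fun y => σ * U (-1 + q.1) y 2)) (frameCLM e (q.2.1, n₀ q, q.2.2)) (Jvec e) (Jvec e) =
          -κt q.1 q.2.2 ∧
        κt q.1 q.2.2 * (fderiv ℝ n₀ q ((0 : ℝ), (0 : ℝ), (1 : ℝ))) ^ 2 =
          (deriv (deriv (R q.1)) q.2.2 - μ (-1 + q.1) q.2.2 * κt q.1 q.2.2) * (1 + (fderiv ℝ n₀ q ((0 : ℝ), (1 : ℝ), (0 : ℝ))) ^ 2))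
    (hsonI : ∀ τ : ℝ, |τ| < δ' → ∃ A B : ℝ, ∀ z : ℝ, |z| < δ' → R τ z = A + B * z)
    (hparI : ∀ τ s z : ℝ, |τ| < δ' → |z| < δ' → n₀ (τ, s, z) = n₀ (τ, (0 : ℝ), z))
    (hP0 : ∀ y : Y3, |y.1 + 1| < δ' → |y.2.2| < δ' →
      (PST (uncurry U) e ∘ shearMap e (fun q : ℝ × ℝ => n₀ (q.1 + 1, (0 : ℝ), q.2))) (y, 0) = 0)
    (hQ0 : ∀ y : Y3, |y.1 + 1| < δ' → |y.2.2| < δ' →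
      (QST (uncurry U) e ∘ shearMap e (fun q : ℝ × ℝ => n₀ (q.1 + 1, (0 : ℝ), q.2))) (y, 0) = 0) :
    False := by
  set O : Set Y3 := {y | |y.1 + 1| < δ' ∧ |y.2.2| < δ'} with hO_def
  have hO : IsOpen O := by
    refine IsOpen.and ?_ ?_
    · exact isOpen_lt (continuous_abs.comp (continuous_fst.add continuous_const)) continuous_const
    · exact isOpen_lt (continuous_abs.comp (continuous_snd.comp continuous_snd)) continuous_const
  have hOne : O.Nonempty := ⟨((-1 : ℝ), (0 : ℝ), (0 : ℝ)), by simp [hO_def, hδ']⟩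
  have hObox : ∀ y ∈ O, |y.1 + 1| < δ' ∧ |y.2.2| < δ' := fun y hy => hy
  set Dμ : Set (ℝ × ℝ) := {q | |q.1 + 1| < δ' ∧ |q.2| < δ'} with hDμ_def
  have hDμ : IsOpen Dμ := by
    refine IsOpen.and ?_ ?_
    · exact isOpen_lt (continuous_abs.comp (continuous_fst.add continuous_const)) continuous_const
    · exact isOpen_lt (continuous_abs.comp continuous_snd) continuous_const
  have hμs : ContDiffOn ℝ ∞ (uncurry μ) Dμ := slope_smooth_on_box hrate hcont hmild hdiv hslabU hδ'ρ hδ'h he2 hpack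
  have hOμ : ∀ y ∈ O, (y.1, y.2.2) ∈ Dμ := fun y hy => hy
  have hμ1 : ∀ y ∈ O, μ y.1 y.2.2 ≠ 1 := fun y hy =>
    (slope_ne_one_on_box hrate hcont hmild hdiv hσ hμ3 hslabU hδ'ρ hδ'h he2 hunit hpack hsonI hparI hy.1 hy.2).2
  exact caseI_sfree_false hrate hcont hmild hdiv hpol hUne hσ hμ3 hslabU hδ'ρ hδ'h he2 hunit hpack hsonI hparI hO hOne hObox hDμ hμs hOμ hμ1
    (fun y hy => hP0 y hy.1 hy.2) (fun y hy => hQ0 y hy.1 hy.2)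

end Summit.NavierStokesRegularity.NavierStokesRegularity.Theorems.PoloidalWindowDoorLrcModEntireCaseISfreeBox
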